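import Mathlib.RingTheory.Coprime.Lemmas
import Mathlib.RingTheory.Ideal.Span
import Mathlib.Algebra.Ring.GeomSum
import Mathlib.Algebra.Ring.Equiv
import Mathlib.Tactic.LinearCombination
import HarnessLib

/-!
# `q`-th powers modulo `q²`: an integral substitute for the Selmer condition of [Schoof2009, Ch. 10, 14]

[Schoof2009, Ch. 10, p. 67] calls `α ∈ ℚ(ζ_p)^*` "a `q`-adic `q`-th power" if it is a `q`-th power in every
completion at a prime over `q`, and defines the Selmer group
`S = {α ∈ H : α is a q-adic q-th power}`.  In the proof of [Schoof2009, Theorem 14.1] this condition is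
only ever used through [Schoof2009, Proposition 14.2], i.e. through the congruence "`≡ u^q (mod q²)`"
("every cyclotomic `p`-unit is congruent to a `q`-th power modulo `q²`", p. 93).  We therefore work with
the following finite-level, integral condition on an element `z` of a commutative ring `R` (for us
`R = 𝓞 K`), written out in full wherever it occurs (no definition is introduced):

`Sel(z) :⟺ ∃ u c : R, IsCoprime c q ∧ q² ∣ z c^q - u^q`

("`z` is a `q`-th power modulo `q²` up to `q`-th powers of `q`-units").  This file proves its closure
properties: products, powers, `q`-th powers of `q`-units, images under ring homomorphisms, passage along
congruences modulo `q²`, **descent along `q`-th powers** (`Sel(w δ^q) ⟹ Sel(w)` for `δ` prime to `q`),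
and the **bridge** to a plain congruence `z ≡ U^q (mod q²)` ([Schoof2009, Exercise 10.1]).

## References

* R. Schoof, *Catalan's Conjecture*, Universitext, Springer 2009, Ch. 10 (p. 67, Selmer group;
  Exercise 10.1) and Ch. 14 (proof of Theorem 14.1, Proposition 14.2). [Schoof2009]
-/

namespace Literature.NumberTheory.DiophantineGeometry

namespace Catalan.Sel

variable {R : Type*} [CommRing R]

/-- `Sel(1)`. [folklore] -/
theorem one (q : ℕ) : ∃ u c : R, IsCoprime c (q : R) ∧ (q : R) ^ 2 ∣ 1 * c ^ q - u ^ q :=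
  ⟨1, 1, isCoprime_one_left, by rw [one_mul, one_pow, sub_self]; exact dvd_zero _⟩

/-- **`q`-th powers are `Sel`**: `Sel(w^q)`. [folklore] -/
theorem pow_self (q : ℕ) (w : R) :
    ∃ u c : R, IsCoprime c (q : R) ∧ (q : R) ^ 2 ∣ w ^ q * c ^ q - u ^ q :=
  ⟨w, 1, isCoprime_one_left, by rw [one_pow, mul_one, sub_self]; exact dvd_zero _⟩

/-- **Products**: `Sel(z) ∧ Sel(z') ⟹ Sel(z z')`. [cite: Schoof2009, Ch. 10 (p. 67: "`S` is a subgroup")] -/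
theorem mul {q : ℕ} {z z' : R}
    (hz : ∃ u c : R, IsCoprime c (q : R) ∧ (q : R) ^ 2 ∣ z * c ^ q - u ^ q)
    (hz' : ∃ u c : R, IsCoprime c (q : R) ∧ (q : R) ^ 2 ∣ z' * c ^ q - u ^ q) :
    ∃ u c : R, IsCoprime c (q : R) ∧ (q : R) ^ 2 ∣ z * z' * c ^ q - u ^ q := by
  obtain ⟨u, c, hc, hdvd⟩ := hz
  obtain ⟨u', c', hc', hdvd'⟩ := hz'
  refine ⟨u * u', c * c', hc.mul_left hc', ?_⟩
  have : z * z' * (c * c') ^ q - (u * u') ^ q =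
      (z * c ^ q - u ^ q) * (z' * c' ^ q) + u ^ q * (z' * c' ^ q - u' ^ q) := by ring
  rw [this]
  exact dvd_add (dvd_mul_of_dvd_left hdvd _) (dvd_mul_of_dvd_right hdvd' _)

/-- **Powers**: `Sel(z) ⟹ Sel(z^k)`. [folklore] -/
theorem pow {q : ℕ} {z : R}
    (hz : ∃ u c : R, IsCoprime c (q : R) ∧ (q : R) ^ 2 ∣ z * c ^ q - u ^ q) (k : ℕ) :
    ∃ u c : R, IsCoprime c (q : R) ∧ (q : R) ^ 2 ∣ z ^ k * c ^ q - u ^ q := by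
  induction k with
  | zero => rw [pow_zero]; exact one q
  | succ k ih => rw [pow_succ z k]; exact mul ih hz

/-- **Finite products**. [folklore] -/
theorem prod {q : ℕ} {ι : Type*} (s : Finset ι) {z : ι → R}
    (hz : ∀ i ∈ s, ∃ u c : R, IsCoprime c (q : R) ∧ (q : R) ^ 2 ∣ z i * c ^ q - u ^ q) :
    ∃ u c : R, IsCoprime c (q : R) ∧ (q : R) ^ 2 ∣ (∏ i ∈ s, z i) * c ^ q - u ^ q := by
  classical
  induction s using Finset.induction_on with
  | empty => rw [Finset.prod_empty]; exact one q
  | insert j s hj ih =>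
    rw [Finset.prod_insert hj]
    exact mul (hz j (Finset.mem_insert_self j s)) (ih fun i hi => hz i (Finset.mem_insert_of_mem hi))

/-- **Descent along `q`-th powers of `q`-units**: `Sel(w δ^q)` with `δ` prime to `q` gives `Sel(w)`
(`(w δ^q) c^q - u^q = w (δ c)^q - u^q`). [folklore] -/
theorem of_mul_pow {q : ℕ} {w δ : R} (hδ : IsCoprime δ (q : R))
    (h : ∃ u c : R, IsCoprime c (q : R) ∧ (q : R) ^ 2 ∣ w * δ ^ q * c ^ q - u ^ q) :
    ∃ u c : R, IsCoprime c (q : R) ∧ (q : R) ^ 2 ∣ w * c ^ q - u ^ q := by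
  obtain ⟨u, c, hc, hdvd⟩ := h
  refine ⟨u, δ * c, hδ.mul_left hc, ?_⟩
  rwa [mul_pow, ← mul_assoc]

/-- **Multiplication by `q`-th powers** (the other direction): `Sel(w) ⟹ Sel(w δ^q)`. [folklore] -/
theorem mul_pow_of {q : ℕ} {w : R} (δ : R)
    (h : ∃ u c : R, IsCoprime c (q : R) ∧ (q : R) ^ 2 ∣ w * c ^ q - u ^ q) :
    ∃ u c : R, IsCoprime c (q : R) ∧ (q : R) ^ 2 ∣ w * δ ^ q * c ^ q - u ^ q :=
  mul h (pow_self q δ)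

/-- **Congruences modulo `q²` do not matter**: `Sel(z)` and `q² ∣ z' - z` give `Sel(z')`. [folklore] -/
theorem of_sq_dvd_sub {q : ℕ} {z z' : R} (hzz' : (q : R) ^ 2 ∣ z' - z)
    (hz : ∃ u c : R, IsCoprime c (q : R) ∧ (q : R) ^ 2 ∣ z * c ^ q - u ^ q) :
    ∃ u c : R, IsCoprime c (q : R) ∧ (q : R) ^ 2 ∣ z' * c ^ q - u ^ q := by
  obtain ⟨u, c, hc, hdvd⟩ := hz
  refine ⟨u, c, hc, ?_⟩
  have : z' * c ^ q - u ^ q = (z * c ^ q - u ^ q) + (z' - z) * c ^ q := by ring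
  rw [this]
  exact dvd_add hdvd (dvd_mul_of_dvd_left hzz' _)

/-- **Ring homomorphisms preserve `Sel`** (they fix `q`): `Sel(z) ⟹ Sel(σ z)` (used for the Galois
action on `𝓞 K`; [Schoof2009, p. 67]: "`S` … is an `𝔽_q[G]`-submodule"). [cite: Schoof2009, Ch. 10 (p. 67)] -/
theorem map {S : Type*} [CommRing S] (σ : R →+* S) {q : ℕ} {z : R}
    (hz : ∃ u c : R, IsCoprime c (q : R) ∧ (q : R) ^ 2 ∣ z * c ^ q - u ^ q) :
    ∃ u c : S, IsCoprime c (q : S) ∧ (q : S) ^ 2 ∣ σ z * c ^ q - u ^ q := by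
  obtain ⟨u, c, hc, hdvd⟩ := hz
  refine ⟨σ u, σ c, ?_, ?_⟩
  · have := hc.map σ
    rwa [map_natCast] at this
  · have := map_dvd σ hdvd
    rwa [map_pow, map_natCast, map_sub, map_mul, map_pow, map_pow] at this

/-- `(1 + t)^q ≡ 1 (mod t)`. [folklore] -/
theorem dvd_one_add_pow_sub_one (t : R) (q : ℕ) : t ∣ (1 + t) ^ q - 1 := by
  have := sub_dvd_pow_sub_pow (1 + t) 1 q
  rwa [one_pow, add_sub_cancel_left] at this

/-- **Bridge to a plain congruence** ([Schoof2009, Exercise 10.1] in our setting): `Sel(z)` gives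
`U ∈ R` with `q² ∣ z - U^q`.  Indeed if `a c + b q² = 1` then `(a c)^q ≡ 1` and
`z ≡ z (a c)^q = (z c^q) a^q ≡ (u a)^q (mod q²)`. [cite: Schoof2009, Exercise 10.1] -/
theorem exists_sq_dvd_sub_pow {q : ℕ} {z : R}
    (hz : ∃ u c : R, IsCoprime c (q : R) ∧ (q : R) ^ 2 ∣ z * c ^ q - u ^ q) :
    ∃ U : R, (q : R) ^ 2 ∣ z - U ^ q := by
  obtain ⟨u, c, hc, hdvd⟩ := hz
  obtain ⟨a, b, hab⟩ := hc.pow_right (n := 2)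
  refine ⟨u * a, ?_⟩
  -- `z - (u a)^q = z (1 - (a c)^q) + a^q (z c^q - u^q)`
  have h1 : (q : R) ^ 2 ∣ 1 - (a * c) ^ q := by
    have h2 : a * c = 1 + (-(b * (q : R) ^ 2)) := by linear_combination hab
    rw [h2, ← neg_sub]
    exact (Dvd.intro_left _ rfl : (q : R) ^ 2 ∣ b * (q : R) ^ 2).neg_right.trans
      (dvd_one_add_pow_sub_one _ q) |>.neg_right
  have : z - (u * a) ^ q = z * (1 - (a * c) ^ q) + a ^ q * (z * c ^ q - u ^ q) := by ring
  rw [this]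
  exact dvd_add (dvd_mul_of_dvd_right h1 _) (dvd_mul_of_dvd_right hdvd _)

/-- Conversely a plain congruence `q² ∣ z - U^q` gives `Sel(z)`. [folklore] -/
theorem of_sq_dvd_sub_pow {q : ℕ} {z U : R} (h : (q : R) ^ 2 ∣ z - U ^ q) :
    ∃ u c : R, IsCoprime c (q : R) ∧ (q : R) ^ 2 ∣ z * c ^ q - u ^ q :=
  ⟨U, 1, isCoprime_one_left, by rwa [one_pow, mul_one]⟩

/-- **`Sel(z)` makes `z` a `q`-unit modulo nothing: if `z` is prime to `q`, so is any `U` with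
`q² ∣ z - U^q`** (bookkeeping for iterating the bridge). [folklore] -/
theorem isCoprime_of_sq_dvd_sub_pow {q : ℕ} (hq : q ≠ 0) {z U : R} (hz : IsCoprime z (q : R))
    (h : (q : R) ^ 2 ∣ z - U ^ q) : IsCoprime U (q : R) := by
  -- `U^q = z - (z - U^q)` is prime to `q`
  have h1 : IsCoprime (U ^ q) (q : R) := by
    obtain ⟨t, ht⟩ := h
    have h2 : U ^ q = z + (-(t * (q : R))) * (q : R) := by
      rw [pow_two] at ht
      linear_combination (-1 : R) * ht
    rw [h2]
    exact hz.add_mul_right_left _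
  exact (IsCoprime.pow_left_iff (Nat.pos_of_ne_zero hq)).mp h1

end Catalan.Sel

end Literature.NumberTheory.DiophantineGeometry
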